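/-
Copyright: the b2b-balaban T⁴-continuum CRUX team, row NE7b OWNER lineage `t4-ne7b-p1` (gen 117). Project licence.
-/
import Mathlib.Algebra.Order.Chebyshev
import Summits.QuantumFields.BalabanUV.T4Continuum.Spine.NE7b.SupTorusDirichletForm

/-!
# THE TORUS DIRICHLET FORM OF `Δ^η + aQ′*Q′` IS COERCIVE, MESH- AND VOLUME-FREE:
# `min(2,a)·Σ_x φ x² ≤ Σ_x φ x·(Rf (A (Ef φ))) x` on the fine torus `(ℤ∕(n+1)s)^d`, every `d`, every side `n+1`, every
# period `s ≥ 1` — B6QGQLower276's per-block floor `block_lower` summed over TDF's block chart of the tori after the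
# TORUS summation by parts; and THE BLOCK JENSEN LETTER `(n+1)^d·Σ_y ((Q′t h) y)² ≤ Σ_x (h x)²`
# (row NE7b, node U5c; TDF + `B6QGQLower276.block_lower` + `B5Hk103ScalarZd.tsum_lapKer_mul` BY NAME; [folklore])

Cell `pub-balaban`, sub-cell `t4`, spine estimate NE7b (`T4WeightBudget.RelWeightBound`; the cell's OWN estimate — NOT PRINTED in
[Bałaban 1983–89], NOT PROVED).  Crux-route work under `Spine/NE7b/` by the row OWNER (`t4-ne7b-p1` gen 117) under FREEZE (0)'s
crux-prover clause, on leaf-03 g156's located item («NOT typed: the Hessian's FLOOR on the torus (coercivity of the torus Dirichlet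
form — HSAH `floor_hessian_comp_branch`'s input)», `…SupTorusEffectiveActionHessian` docstring); NOTHING of Bałaban's is named as a
Lean object, valued or asserted; no `T4Continuum/Support` leaf typed; no `def`, no notation (the torus shifts are `siteOf (e μ)`, the
torus block map and the block chart are written out as in TDF; every operator enters through its DISPLAYED action and every law is
stated FOR ANY maps with those actions); zero `sorry`.  Imports (BY NAME): leaf-03's TDF `…SupTorusDirichletForm`
(`sum_fine_eq_sum_blocks`, `siteOf_chart_bijective`; through it PTC `exists_windowMap_siteOf` ∕ `siteOf_add_smul` ∕
`natCast_mul_smul_eq`, the OWNER's (55) `blk_translate` ∕ `sum_B_translate`, the Literature columns `B6QGQLower276` (`AX`, `lapKer`,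
`sameBlk`, `chart`, `chart_stepUp`, `sum_B`, `sum_B_const`, **`block_lower`** — the per-block Poincaré floor
`min(2,a)·Σ_z g² ≤ (n+1)²·(block bonds) + a(n+1)^{−d}(Σ_z g)²`), `B5Hk103ScalarZd` (`nbhd`, `tsum_AX_mul`, `tsum_lapKer_mul`) and
the torus dictionary `Beta.{Site, siteOf, windowMap, siteOf_add, siteOf_sub}`), `Mathlib.Algebra.Order.Chebyshev` (`sq_sum_le_card_mul_sum_sq`).

WHY (located).  The sup road's torus junction (TDF ∕ TEA ∕ INST ∕ HESS, leaf-03 g156) identified the Hessian of the torus effective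
action `S∘σt` with `(n+1)^d ×` the next-scale operator's form, and HSAH (leaf-04) turns a FLOOR of `S″(σt w)` on the response directions
into a floor of that Hessian.  `S″(φ)[h,h] = Σ_x h·(At h) + Σ_x u′(φ x)·h x²`, so the missing input is a floor for the torus form of the
site operator `A = Δ^η + aQ′*Q′`.  On `ℤ^d` the Literature column `B6QGQLower276.coercive_AX` gives `min(2,a)·Σ w² ≤ ⟨w, Aw⟩` for
finitely supported `w` (block by block: Poincaré in the block + the block-mean term); a periodic field is not finitely supported, but
the SAME per-block floor `block_lower` applies on the torus once (i) the torus Laplacian form is written as a sum of squared TORUS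
bond differences (summation by parts on the finite group `(ℤ∕N)^d`, valid at every period including `N ≤ 2`) and (ii) the
intra-block bonds are recognised among the torus bonds through TDF's block chart.  The constant `min(2,a)` is the `ℤ^d` one: no mesh,
no volume, no dimension.  With the block Jensen letter the successor file turns it into the floor
`(min(2,a) − λ)·(n+1)^d·Σ_y k²` of HESS's Hessian.

WHAT IS PROVED ([folklore]; fine torus `Site d N`, `[NeZero N]`; for the block statements `N = (n+1)s`, coarse torus `Site d s`,
`[NeZero s]`; `ê_μ := siteOf (e μ)`; `Φ := φ ∘ siteOf` the periodic lattice representative):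
* §1 **`torus_lapForm_eq`** (for ANY family of shifts `t_μ` of a finite torus:
  `Σ_x φ x·Σ_μ (2φ x − φ(x+t_μ) − φ(x−t_μ)) = Σ_μ Σ_x (φ(x+t_μ) − φ x)²` — THE TORUS LAPLACIAN FORM IS A SUM OF SQUARED BOND
  DIFFERENCES, every period, by translating the summation variable).
* §2 **`row_comp_siteOf`** (the row formula of `A` on a periodic representative:
  `Σ_{r∈nbhd p} A(p,r)Φ(r) = (n+1)²Σ_μ(2φ(σp) − φ(σp+ê_μ) − φ(σp−ê_μ)) + a(n+1)^{−d}Σ_{q∈B(blk p)} Φ q`).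
* §3 `comp_siteOf_periodic`, `sum_block_comp_siteOf_eq` (the block sum of `Φ` over `B(blk(windowMap x))` is the block sum over the
  window block of the torus block of `x`), **`sum_sq_eq_sum_blocks`** (`Σ_x φ² = Σ_y Σ_z Φ(chart (windowMap y) z)²`),
  **`sum_mul_blockSum_eq`** (`Σ_x φ x·Σ_{q∈B(blk(wm x))} Φ q = Σ_y (Σ_z Φ(chart (wm y) z))²`), **`sum_blockBonds_le`** (the intra-block
  bonds of all torus blocks are among the torus bonds: `Σ_y Σ_{z_μ≠n} (Φ(chart(stepUp z μ)) − Φ(chart z))² ≤ Σ_x (φ(x+ê_μ) − φ x)²`).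
* §4 **`torus_form_coercive_explicit`** (`min(2,a)·Σ_x φ² ≤ Σ_x φ x·((n+1)²Σ_μ(2φ x − φ(x+ê_μ) − φ(x−ê_μ)) + a(n+1)^{−d}Σ_{B(blk(wm x))}Φ)`)
  and THE END **`torus_form_coercive`**: for ANY `Aop` with the site-matrix action and carrier maps `Ef ∕ Rf` with their displayed
  actions, `min(2,a)·Σ_x φ x² ≤ Σ_x φ x·(Rf (Aop (Ef φ))) x` — every `n`, `a`, `s`, `d`; `torus_operator_form_coercive` (SLT spelling
  `At := Rf∘Aop∘Ef`).
* §5 **`blockVolume_mul_sum_sq_blockAvg_le`** (THE BLOCK JENSEN LETTER: for ANY `Dop` with the block-average action and carrier maps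
  `Ef ∕ Rc`, `(n+1)^d·Σ_y (Rc (Dop (Ef h)) y)² ≤ Σ_x (h x)²`).
* §6 toy.

HONEST (what this is NOT).  Finite sums on the tori + the tree's per-block Poincaré floor; the constant `min(2,a)` is OURS (B6QGQLower276's,
not a printed one) and is not sharp; no `Δ_a ≥ γ₀(Δ + I)`-type bound (B5 (1.83)), only `≥ min(2,a)·I`; cubic periods only; scalar
skeleton (`U = 1`), not the covariant operators ((A3), NC-NE7b-α UNRULED); nothing of Bałaban's.  BY-NAME EFFECT ON THE WALL: NONE.
NE7b NOT PRINTED ∕ NOT PROVED; spine PROVED 0∕9; rung (B)+1 on a FINITE torus — NOT infinite volume, NOT the mass gap, NOT Clay.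
HONEST DEPENDENCY: continuum YM on T⁴ ⇐ BetaPertH ∧ nine spine estimates (0∕9 proved); BetaPertH ⇐ (D1) ∧ (D4) ∧ CAP+tail; G-an2-4
gates asym, D1 and NE2∕3∕4.
-/

set_option autoImplicit false

noncomputable section

namespace Summit.QuantumFields.BalabanUV.T4Continuum.NE7b.SupTorusDirichletFormCoercive

open scoped ENNReal
open Literature.MathematicalPhysics.QuantumFieldTheory.Balaban1983to89
open B6QGQLower276 (X e blk B side AX chart mem_B sum_B sum_B_const lapKer sameBlk block_lower chart_stepUp)
open B5Hk103ScalarZd (nbhd tsum_AX_mul tsum_lapKer_mul lapKer_eq_zero_of_not_mem)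
open Beta (Site siteOf windowMap siteOf_windowMap siteOf_add siteOf_sub)
open Beta.CoordCubePoincare (stepUp)
open OneShotChartTorusRowsZd (blk_translate sum_B_translate)
open PeriodicSupTorusCarrier (exists_windowMap_siteOf siteOf_add_smul natCast_mul_smul_eq)
open SupTorusDirichletForm (sum_fine_eq_sum_blocks siteOf_chart_bijective)

variable {d : ℕ}

/-! ## §1. Torus summation by parts: the Laplacian form is a sum of squared bond differences -/

/-- **THE TORUS LAPLACIAN FORM IS A SUM OF SQUARED BOND DIFFERENCES** (every period `N ≥ 1`, ANY family of shifts `t_μ`):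
`Σ_x φ x·Σ_μ (2φ x − φ(x + t_μ) − φ(x − t_μ)) = Σ_μ Σ_x (φ(x + t_μ) − φ x)²`. [folklore] -/
theorem torus_lapForm_eq {N : ℕ} [NeZero N] {ι : Type*} [Fintype ι] (t : ι → Site d N) (φ : Site d N → ℝ) :
    ∑ x, φ x * ∑ μ, (2 * φ x - φ (x + t μ) - φ (x - t μ)) = ∑ μ, ∑ x, (φ (x + t μ) - φ x) ^ 2 := by
  calc ∑ x, φ x * ∑ μ, (2 * φ x - φ (x + t μ) - φ (x - t μ))
      = ∑ x, ∑ μ, φ x * (2 * φ x - φ (x + t μ) - φ (x - t μ)) :=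
        Finset.sum_congr rfl fun x _ => Finset.mul_sum _ _ _
    _ = ∑ μ, ∑ x, φ x * (2 * φ x - φ (x + t μ) - φ (x - t μ)) := Finset.sum_comm
    _ = ∑ μ, ∑ x, (φ (x + t μ) - φ x) ^ 2 := by
        refine Finset.sum_congr rfl fun μ _ => ?_
        -- translating the summation variable by `t μ` (a bijection of the finite torus) does not change a sum
        have h1 : ∑ x, φ x * φ (x - t μ) = ∑ x, φ (x + t μ) * φ x := by
          rw [← Fintype.sum_equiv (Equiv.addRight (t μ)) (fun x => φ (x + t μ) * φ (x + t μ - t μ))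
            (fun x => φ x * φ (x - t μ)) fun _ => rfl]
          exact Finset.sum_congr rfl fun x _ => by rw [add_sub_cancel_right]
        have h2 : ∑ x, φ (x + t μ) ^ 2 = ∑ x, φ x ^ 2 :=
          Fintype.sum_equiv (Equiv.addRight (t μ)) (fun x => φ (x + t μ) ^ 2) (fun x => φ x ^ 2) fun _ => rfl
        have hL : ∑ x, φ x * (2 * φ x - φ (x + t μ) - φ (x - t μ))
            = 2 * ∑ x, φ x ^ 2 - ∑ x, φ x * φ (x + t μ) - ∑ x, φ x * φ (x - t μ) := by
          rw [Finset.mul_sum, ← Finset.sum_sub_distrib, ← Finset.sum_sub_distrib]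
          exact Finset.sum_congr rfl fun x _ => by ring
        have hR : ∑ x, (φ (x + t μ) - φ x) ^ 2
            = ∑ x, φ (x + t μ) ^ 2 - 2 * ∑ x, φ (x + t μ) * φ x + ∑ x, φ x ^ 2 := by
          rw [Finset.mul_sum, ← Finset.sum_sub_distrib, ← Finset.sum_add_distrib]
          exact Finset.sum_congr rfl fun x _ => by ring
        have h3 : ∑ x, φ x * φ (x + t μ) = ∑ x, φ (x + t μ) * φ x := Finset.sum_congr rfl fun x _ => mul_comm _ _
        rw [hL, hR, h1, h2, h3]
        ring

/-! ## §2. The row formula of `Δ^η + aQ′*Q′` on a periodic representative -/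

/-- **THE ROW FORMULA ON A PERIODIC REPRESENTATIVE**: for `Φ = φ ∘ siteOf`,
`Σ_{r∈nbhd_n p} A(p,r)Φ(r) = (n+1)²·Σ_μ (2φ(σp) − φ(σp + ê_μ) − φ(σp − ê_μ)) + a(n+1)^{−d}·Σ_{q∈B_n(blk_n p)} Φ q`, `σ = siteOf`,
`ê_μ = siteOf (e μ)` (the OWNER's (76) `sum_nbhd_AX_mul` read through `siteOf`'s additivity; re-derived from `tsum_lapKer_mul`). [folklore] -/
theorem row_comp_siteOf (n : ℕ) (a : ℝ) (N : ℕ) (φ : Site d N → ℝ) (p : X d) :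
    ∑ r ∈ nbhd n p, AX n a p r * φ (siteOf d N r)
      = ((n : ℝ) + 1) ^ 2 * ∑ μ, (2 * φ (siteOf d N p) - φ (siteOf d N p + siteOf d N (e μ))
            - φ (siteOf d N p - siteOf d N (e μ)))
        + a / ((n : ℝ) + 1) ^ d * ∑ q ∈ B n (blk n p), φ (siteOf d N q) := by
  classical
  rw [← tsum_AX_mul]
  have h1 : ∀ r, AX n a p r * φ (siteOf d N r)
      = ((n : ℝ) + 1) ^ 2 * (lapKer p r * φ (siteOf d N r))
        + a / ((n : ℝ) + 1) ^ d * (sameBlk n p r * φ (siteOf d N r)) := fun r => by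
    simp only [AX]; ring
  have hS0 : ∀ r ∉ B n (blk n p), sameBlk n p r * φ (siteOf d N r) = 0 := fun r hr => by
    rw [sameBlk, if_neg (fun h => hr (mem_B.2 h.symm)), zero_mul]
  have hsL : Summable fun r : X d => lapKer p r * φ (siteOf d N r) :=
    summable_of_ne_finset_zero (s := nbhd n p) fun r hr => by rw [lapKer_eq_zero_of_not_mem hr, zero_mul]
  have hsS : Summable fun r : X d => sameBlk n p r * φ (siteOf d N r) :=
    summable_of_ne_finset_zero (s := B n (blk n p)) hS0
  rw [tsum_congr h1, (hsL.mul_left _).tsum_add (hsS.mul_left _), tsum_mul_left, tsum_mul_left, tsum_lapKer_mul,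
    tsum_eq_sum (s := B n (blk n p)) hS0]
  simp only [siteOf_add, siteOf_sub]
  congr 2
  exact Finset.sum_congr rfl fun r hr => by rw [sameBlk, if_pos (mem_B.1 hr).symm, one_mul]

/-! ## §3. Block structure of the torus sums -/

/-- A periodic representative is `(n+1)s`-periodic in the `side n • (s • t)` spelling. [folklore] -/
theorem comp_siteOf_periodic (n s : ℕ) (φ : Site d ((n + 1) * s) → ℝ) (q t : X d) :
    φ (siteOf d ((n + 1) * s) (q + side n • ((s : ℤ) • t))) = φ (siteOf d ((n + 1) * s) q) := by
  rw [← natCast_mul_smul_eq, siteOf_add_smul]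

/-- **THE BLOCK SUM OF A PERIODIC REPRESENTATIVE IS READ ON THE TORUS BLOCK**: for `p ∈ B n (windowMap y)` (so that the torus block of
`siteOf p` is `y`), `Σ_{q ∈ B n (blk n (windowMap (siteOf p)))} Φ q = Σ_{q ∈ B n (windowMap y)} Φ q`. [folklore] -/
theorem sum_block_comp_siteOf_eq (n s : ℕ) [NeZero s] (φ : Site d ((n + 1) * s) → ℝ) {y : Site d s} {p : X d}
    (hp : p ∈ B n (windowMap d s y)) :
    ∑ q ∈ B n (blk n (windowMap d ((n + 1) * s) (siteOf d ((n + 1) * s) p))), φ (siteOf d ((n + 1) * s) q)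
      = ∑ q ∈ B n (windowMap d s y), φ (siteOf d ((n + 1) * s) q) := by
  obtain ⟨m, hm⟩ := exists_windowMap_siteOf ((n + 1) * s) p
  rw [hm, natCast_mul_smul_eq, blk_translate, mem_B.1 hp, sum_B_translate]
  exact Finset.sum_congr rfl fun q _ => comp_siteOf_periodic n s φ q m

/-- **`Σ_x φ x² = Σ_y Σ_z Φ(chart n (windowMap y) z)²`** (TDF's block chart). [folklore] -/
theorem sum_sq_eq_sum_blocks (n s : ℕ) [NeZero s] (φ : Site d ((n + 1) * s) → ℝ) :
    ∑ x, φ x ^ 2 = ∑ y : Site d s, ∑ z : Fin d → Fin (n + 1), φ (siteOf d ((n + 1) * s) (chart n (windowMap d s y) z)) ^ 2 := by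
  rw [sum_fine_eq_sum_blocks n s]
  exact Finset.sum_congr rfl fun y _ => sum_B _ _

/-- **THE BLOCK TERM OF THE TORUS FORM IS A SUM OF SQUARED BLOCK SUMS**:
`Σ_x φ x·Σ_{q∈B n (blk n (windowMap x))} Φ q = Σ_y (Σ_z Φ(chart n (windowMap y) z))²`. [folklore] -/
theorem sum_mul_blockSum_eq (n s : ℕ) [NeZero s] (φ : Site d ((n + 1) * s) → ℝ) :
    ∑ x, φ x * ∑ q ∈ B n (blk n (windowMap d ((n + 1) * s) x)), φ (siteOf d ((n + 1) * s) q)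
      = ∑ y : Site d s, (∑ z : Fin d → Fin (n + 1), φ (siteOf d ((n + 1) * s) (chart n (windowMap d s y) z))) ^ 2 := by
  rw [sum_fine_eq_sum_blocks n s]
  refine Finset.sum_congr rfl fun y _ => ?_
  calc ∑ p ∈ B n (windowMap d s y), φ (siteOf d ((n + 1) * s) p)
          * ∑ q ∈ B n (blk n (windowMap d ((n + 1) * s) (siteOf d ((n + 1) * s) p))), φ (siteOf d ((n + 1) * s) q)
      = ∑ p ∈ B n (windowMap d s y), φ (siteOf d ((n + 1) * s) p)
          * ∑ q ∈ B n (windowMap d s y), φ (siteOf d ((n + 1) * s) q) :=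
        Finset.sum_congr rfl fun p hp => by rw [sum_block_comp_siteOf_eq n s φ hp]
    _ = (∑ p ∈ B n (windowMap d s y), φ (siteOf d ((n + 1) * s) p))
          * ∑ q ∈ B n (windowMap d s y), φ (siteOf d ((n + 1) * s) q) := by rw [Finset.sum_mul]
    _ = (∑ z : Fin d → Fin (n + 1), φ (siteOf d ((n + 1) * s) (chart n (windowMap d s y) z))) ^ 2 := by
        rw [sum_B, sq]

/-- **THE INTRA-BLOCK BONDS OF ALL TORUS BLOCKS ARE AMONG THE TORUS BONDS** (direction `μ`):
`Σ_y Σ_{z : z μ ≠ n} (Φ(chart n (wm y) (stepUp z μ)) − Φ(chart n (wm y) z))² ≤ Σ_x (φ(x + ê_μ) − φ x)²`. [folklore] -/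
theorem sum_blockBonds_le (n s : ℕ) [NeZero s] (φ : Site d ((n + 1) * s) → ℝ) (μ : Fin d) :
    ∑ y : Site d s, ∑ z ∈ Finset.univ.filter (fun z : Fin d → Fin (n + 1) => z μ ≠ Fin.last n),
        (φ (siteOf d ((n + 1) * s) (chart n (windowMap d s y) (stepUp z μ)))
          - φ (siteOf d ((n + 1) * s) (chart n (windowMap d s y) z))) ^ 2
      ≤ ∑ x, (φ (x + siteOf d ((n + 1) * s) (e μ)) - φ x) ^ 2 := by
  classical
  -- through the block chart `(y, z) ↦ siteOf (chart n (windowMap y) z)` the right side is a sum over ALL `(y, z)`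
  have hR : ∑ x, (φ (x + siteOf d ((n + 1) * s) (e μ)) - φ x) ^ 2
      = ∑ y : Site d s, ∑ z : Fin d → Fin (n + 1),
          (φ (siteOf d ((n + 1) * s) (chart n (windowMap d s y) z) + siteOf d ((n + 1) * s) (e μ))
            - φ (siteOf d ((n + 1) * s) (chart n (windowMap d s y) z))) ^ 2 := by
    rw [← (siteOf_chart_bijective (d := d) n s).sum_comp
      (fun x => (φ (x + siteOf d ((n + 1) * s) (e μ)) - φ x) ^ 2), Fintype.sum_prod_type]
  rw [hR]
  refine Finset.sum_le_sum fun y _ => ?_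
  calc ∑ z ∈ Finset.univ.filter (fun z : Fin d → Fin (n + 1) => z μ ≠ Fin.last n),
        (φ (siteOf d ((n + 1) * s) (chart n (windowMap d s y) (stepUp z μ)))
          - φ (siteOf d ((n + 1) * s) (chart n (windowMap d s y) z))) ^ 2
      = ∑ z ∈ Finset.univ.filter (fun z : Fin d → Fin (n + 1) => z μ ≠ Fin.last n),
        (φ (siteOf d ((n + 1) * s) (chart n (windowMap d s y) z) + siteOf d ((n + 1) * s) (e μ))
          - φ (siteOf d ((n + 1) * s) (chart n (windowMap d s y) z))) ^ 2 := by
        refine Finset.sum_congr rfl fun z hz => ?_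
        rw [chart_stepUp n _ (Finset.mem_filter.1 hz).2, siteOf_add]
    _ ≤ ∑ z : Fin d → Fin (n + 1),
        (φ (siteOf d ((n + 1) * s) (chart n (windowMap d s y) z) + siteOf d ((n + 1) * s) (e μ))
          - φ (siteOf d ((n + 1) * s) (chart n (windowMap d s y) z))) ^ 2 :=
        Finset.sum_le_sum_of_subset_of_nonneg (Finset.filter_subset _ _) fun z _ _ => sq_nonneg _

/-! ## §4. Coercivity of the torus form -/

/-- **THE TORUS FORM OF `Δ^η + aQ′*Q′` IS COERCIVE — explicit form**: for every fine torus field `φ` on `(ℤ∕(n+1)s)^d`,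
`min(2,a)·Σ_x φ x² ≤ Σ_x φ x·((n+1)²Σ_μ(2φ x − φ(x + ê_μ) − φ(x − ê_μ)) + a(n+1)^{−d}·Σ_{q∈B n (blk n (windowMap x))} Φ q)`.
Per block: `B6QGQLower276.block_lower`; the intra-block bonds are among the torus bonds (§3), the inter-block and wrap-around bonds
are dropped (nonnegative). [folklore] -/
theorem torus_form_coercive_explicit (n : ℕ) (a : ℝ) (s : ℕ) [NeZero s] (φ : Site d ((n + 1) * s) → ℝ) :
    min 2 a * ∑ x, φ x ^ 2
      ≤ ∑ x, φ x *
          (((n : ℝ) + 1) ^ 2 * ∑ μ, (2 * φ x - φ (x + siteOf d ((n + 1) * s) (e μ)) - φ (x - siteOf d ((n + 1) * s) (e μ)))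
            + a / ((n : ℝ) + 1) ^ d
              * ∑ q ∈ B n (blk n (windowMap d ((n + 1) * s) x)), φ (siteOf d ((n + 1) * s) q)) := by
  classical
  -- split the right side into the Laplacian form (a sum of squared torus bonds, §1) and the block form (§3)
  have hsplit : ∑ x, φ x *
        (((n : ℝ) + 1) ^ 2 * ∑ μ, (2 * φ x - φ (x + siteOf d ((n + 1) * s) (e μ)) - φ (x - siteOf d ((n + 1) * s) (e μ)))
          + a / ((n : ℝ) + 1) ^ d
            * ∑ q ∈ B n (blk n (windowMap d ((n + 1) * s) x)), φ (siteOf d ((n + 1) * s) q))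
      = ((n : ℝ) + 1) ^ 2 * ∑ μ : Fin d, ∑ x, (φ (x + siteOf d ((n + 1) * s) (e μ)) - φ x) ^ 2
        + a / ((n : ℝ) + 1) ^ d
          * ∑ y : Site d s, (∑ z : Fin d → Fin (n + 1), φ (siteOf d ((n + 1) * s) (chart n (windowMap d s y) z))) ^ 2 := by
    rw [← torus_lapForm_eq (fun μ => siteOf d ((n + 1) * s) (e μ)) φ, ← sum_mul_blockSum_eq n s φ, Finset.mul_sum,
      Finset.mul_sum, ← Finset.sum_add_distrib]
    exact Finset.sum_congr rfl fun x _ => by ring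
  rw [hsplit, sum_sq_eq_sum_blocks n s φ, Finset.mul_sum]
  -- per block: `block_lower`
  have hblock : ∀ y : Site d s,
      min 2 a * ∑ z : Fin d → Fin (n + 1), φ (siteOf d ((n + 1) * s) (chart n (windowMap d s y) z)) ^ 2
        ≤ ((n : ℝ) + 1) ^ 2 * ∑ μ : Fin d, ∑ z ∈ Finset.univ.filter (fun z : Fin d → Fin (n + 1) => z μ ≠ Fin.last n),
              (φ (siteOf d ((n + 1) * s) (chart n (windowMap d s y) (stepUp z μ)))
                - φ (siteOf d ((n + 1) * s) (chart n (windowMap d s y) z))) ^ 2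
          + a / ((n : ℝ) + 1) ^ d
            * (∑ z : Fin d → Fin (n + 1), φ (siteOf d ((n + 1) * s) (chart n (windowMap d s y) z))) ^ 2 := fun y =>
    block_lower n a (fun z => φ (siteOf d ((n + 1) * s) (chart n (windowMap d s y) z)))
  calc ∑ y : Site d s, min 2 a * ∑ z : Fin d → Fin (n + 1), φ (siteOf d ((n + 1) * s) (chart n (windowMap d s y) z)) ^ 2
      ≤ ∑ y : Site d s,
          (((n : ℝ) + 1) ^ 2 * ∑ μ : Fin d, ∑ z ∈ Finset.univ.filter (fun z : Fin d → Fin (n + 1) => z μ ≠ Fin.last n),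
              (φ (siteOf d ((n + 1) * s) (chart n (windowMap d s y) (stepUp z μ)))
                - φ (siteOf d ((n + 1) * s) (chart n (windowMap d s y) z))) ^ 2
            + a / ((n : ℝ) + 1) ^ d
              * (∑ z : Fin d → Fin (n + 1), φ (siteOf d ((n + 1) * s) (chart n (windowMap d s y) z))) ^ 2) :=
        Finset.sum_le_sum fun y _ => hblock y
    _ = ((n : ℝ) + 1) ^ 2 * ∑ μ : Fin d, ∑ y : Site d s,
            ∑ z ∈ Finset.univ.filter (fun z : Fin d → Fin (n + 1) => z μ ≠ Fin.last n),
              (φ (siteOf d ((n + 1) * s) (chart n (windowMap d s y) (stepUp z μ)))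
                - φ (siteOf d ((n + 1) * s) (chart n (windowMap d s y) z))) ^ 2
          + a / ((n : ℝ) + 1) ^ d
            * ∑ y : Site d s, (∑ z : Fin d → Fin (n + 1), φ (siteOf d ((n + 1) * s) (chart n (windowMap d s y) z))) ^ 2 := by
        rw [Finset.sum_add_distrib, ← Finset.mul_sum, ← Finset.mul_sum, Finset.sum_comm]
    _ ≤ ((n : ℝ) + 1) ^ 2 * ∑ μ : Fin d, ∑ x, (φ (x + siteOf d ((n + 1) * s) (e μ)) - φ x) ^ 2
          + a / ((n : ℝ) + 1) ^ d
            * ∑ y : Site d s, (∑ z : Fin d → Fin (n + 1), φ (siteOf d ((n + 1) * s) (chart n (windowMap d s y) z))) ^ 2 := by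
        refine add_le_add (mul_le_mul_of_nonneg_left (Finset.sum_le_sum fun μ _ => ?_) (by positivity)) le_rfl
        exact sum_blockBonds_le n s φ μ

section Carriers

variable (n : ℕ) (a : ℝ) (s : ℕ) [NeZero s]
  {Aop : lp (fun _ : X d => ℝ) ∞ →L[ℝ] lp (fun _ : X d => ℝ) ∞}
  (hA : ∀ (f : lp (fun _ : X d => ℝ) ∞) (p : X d), Aop f p = ∑ r ∈ nbhd n p, AX n a p r * f r)
  {Dop : lp (fun _ : X d => ℝ) ∞ →L[ℝ] lp (fun _ : X d => ℝ) ∞}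
  (hD : ∀ (f : lp (fun _ : X d => ℝ) ∞) (y : X d), Dop f y = (((n : ℝ) + 1) ^ d)⁻¹ * ∑ p ∈ B n y, f p)
  {Ef : (Site d ((n + 1) * s) → ℝ) →L[ℝ] lp (fun _ : X d => ℝ) ∞}
  (hEf : ∀ (g : Site d ((n + 1) * s) → ℝ) (q : X d), Ef g q = g (siteOf d ((n + 1) * s) q))
  {Rf : lp (fun _ : X d => ℝ) ∞ →L[ℝ] (Site d ((n + 1) * s) → ℝ)}
  (hRf : ∀ (h : lp (fun _ : X d => ℝ) ∞) (x : Site d ((n + 1) * s)), Rf h x = h (windowMap d ((n + 1) * s) x))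
  {Rc : lp (fun _ : X d => ℝ) ∞ →L[ℝ] (Site d s → ℝ)}
  (hRc : ∀ (h : lp (fun _ : X d => ℝ) ∞) (x : Site d s), Rc h x = h (windowMap d s x))

include hA hEf hRf in
/-- **THE TORUS OPERATOR IN EXPLICIT FORM**: `(Rf (Aop (Ef φ))) x = (n+1)²Σ_μ(2φ x − φ(x+ê_μ) − φ(x−ê_μ)) + a(n+1)^{−d}Σ_{B(blk(wm x))} Φ`.
[folklore] -/
theorem torus_operator_apply (φ : Site d ((n + 1) * s) → ℝ) (x : Site d ((n + 1) * s)) :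
    Rf (Aop (Ef φ)) x
      = ((n : ℝ) + 1) ^ 2 * ∑ μ, (2 * φ x - φ (x + siteOf d ((n + 1) * s) (e μ)) - φ (x - siteOf d ((n + 1) * s) (e μ)))
        + a / ((n : ℝ) + 1) ^ d * ∑ q ∈ B n (blk n (windowMap d ((n + 1) * s) x)), φ (siteOf d ((n + 1) * s) q) := by
  rw [hRf, hA]
  simp only [hEf]
  rw [row_comp_siteOf, siteOf_windowMap]

include hA hEf hRf in
/-- **THE TORUS DIRICHLET FORM OF `Δ^η + aQ′*Q′` IS COERCIVE, MESH- AND VOLUME-FREE**: for ANY `Aop` with the site-matrix action and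
carrier maps `Ef` (periodisation) ∕ `Rf` (window restriction) with their displayed actions, and every fine torus field `φ` on
`(ℤ∕(n+1)s)^d`: `min(2,a)·Σ_x φ x² ≤ Σ_x φ x·(Rf (Aop (Ef φ))) x` — every `d`, every side `n + 1`, every `a`, every period `s ≥ 1`.
[folklore] -/
theorem torus_form_coercive (φ : Site d ((n + 1) * s) → ℝ) :
    min 2 a * ∑ x, φ x ^ 2 ≤ ∑ x, φ x * Rf (Aop (Ef φ)) x := by
  simp only [torus_operator_apply n a s hA hEf hRf]
  exact torus_form_coercive_explicit n a s φ

include hA hEf hRf in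
/-- **THE SAME FOR THE TORUS OPERATOR `At := Rf ∘ Aop ∘ Ef`** (SLT's spelling). [folklore] -/
theorem torus_operator_form_coercive (φ : Site d ((n + 1) * s) → ℝ) :
    min 2 a * ∑ x, φ x ^ 2 ≤ ∑ x, φ x * ((Rf.comp Aop).comp Ef) φ x :=
  torus_form_coercive n a s hA hEf hRf φ

/-! ## §5. The block Jensen letter -/

include hD hEf hRc in
/-- **THE TORUS BLOCK MEAN IN EXPLICIT FORM**: `(Rc (Dop (Ef h))) y = (n+1)^{−d}·Σ_z h(siteOf (chart n (windowMap y) z))`. [folklore] -/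
theorem torus_blockAvg_apply (h : Site d ((n + 1) * s) → ℝ) (y : Site d s) :
    Rc (Dop (Ef h)) y
      = (((n : ℝ) + 1) ^ d)⁻¹ * ∑ z : Fin d → Fin (n + 1), h (siteOf d ((n + 1) * s) (chart n (windowMap d s y) z)) := by
  rw [hRc, hD, sum_B]
  simp only [hEf]

include hD hEf hRc in
/-- **THE BLOCK JENSEN LETTER**: for ANY `Dop` with the block-average action and carrier maps `Ef ∕ Rc` with their displayed actions,
`(n+1)^d·Σ_y (Rc (Dop (Ef h)) y)² ≤ Σ_x (h x)²` — the block volume times the squared block means is at most the sum of squares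
(Cauchy–Schwarz per block). [folklore] -/
theorem blockVolume_mul_sum_sq_blockAvg_le (h : Site d ((n + 1) * s) → ℝ) :
    ((n : ℝ) + 1) ^ d * ∑ y : Site d s, Rc (Dop (Ef h)) y ^ 2 ≤ ∑ x, h x ^ 2 := by
  classical
  have hvol : (0 : ℝ) < ((n : ℝ) + 1) ^ d := by positivity
  have hcard : (Fintype.card (Fin d → Fin (n + 1)) : ℝ) = ((n : ℝ) + 1) ^ d := by simp
  rw [sum_sq_eq_sum_blocks n s h, Finset.mul_sum]
  refine Finset.sum_le_sum fun y _ => ?_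
  rw [torus_blockAvg_apply n s hD hEf hRc h y]
  have hCS := sq_sum_le_card_mul_sum_sq (s := (Finset.univ : Finset (Fin d → Fin (n + 1))))
    (f := fun z => h (siteOf d ((n + 1) * s) (chart n (windowMap d s y) z)))
  rw [Finset.card_univ, hcard] at hCS
  calc ((n : ℝ) + 1) ^ d * ((((n : ℝ) + 1) ^ d)⁻¹
          * ∑ z : Fin d → Fin (n + 1), h (siteOf d ((n + 1) * s) (chart n (windowMap d s y) z))) ^ 2
      = (((n : ℝ) + 1) ^ d)⁻¹
          * (∑ z : Fin d → Fin (n + 1), h (siteOf d ((n + 1) * s) (chart n (windowMap d s y) z))) ^ 2 := by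
        field_simp
    _ ≤ (((n : ℝ) + 1) ^ d)⁻¹
          * (((n : ℝ) + 1) ^ d * ∑ z : Fin d → Fin (n + 1), h (siteOf d ((n + 1) * s) (chart n (windowMap d s y) z)) ^ 2) :=
        mul_le_mul_of_nonneg_left hCS (inv_nonneg.2 hvol.le)
    _ = ∑ z : Fin d → Fin (n + 1), h (siteOf d ((n + 1) * s) (chart n (windowMap d s y) z)) ^ 2 := by
        rw [inv_mul_cancel_left₀ hvol.ne']

end Carriers

/-! ## §6. Toy -/

/-- Toy: on the one-point torus (`d = 0`-free statement at `n = 0`, `s = 1`) the Laplacian form identity reads `0 = 0`-shaped: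
the torus Laplacian form with the empty family of shifts vanishes. -/
example {N : ℕ} [NeZero N] (φ : Site d N → ℝ) :
    ∑ x, φ x * ∑ μ : Fin 0, (2 * φ x - φ (x + (Fin.elim0 μ : Site d N)) - φ (x - (Fin.elim0 μ : Site d N))) = 0 := by
  rw [torus_lapForm_eq]; simp

end Summit.QuantumFields.BalabanUV.T4Continuum.NE7b.SupTorusDirichletFormCoercive

end
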